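import Summits.Ventures.YMGap.Thresholds.TruncatedTreeDecayDim
import Summits.Ventures.YMGap.Thresholds.CouplingSmooth
import Summits.Ventures.YMGap.Thresholds.StateLipschitzStarDim
import HarnessLib

/-!
# Venture YMGap — C-SMOOTH in every dimension (ii): THE `SU(N)` STRONG-COUPLING STATE ON `ℤ^d` IS `C^∞` IN THE COUPLING,
# `dⁿ/dbⁿ ⟨F⟩_b = Nⁿ Σ_{q₁…q_n} u_{n+1}(F; W_{q₁}; …; W_{q_n})` (hypothesis-free for `N ≥ 2`, `d ≥ 2`, `0 < b < N/(12(d−1))`)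

HONEST FRAMING: venture file of the cell `pub-ymgap` (QuantumFields programme), seat ds-1 (gen 12).  Every-`d` twin of
`CouplingSmoothSUN`: strong-coupling LATTICE statement for `SU(N)` lattice Yang–Mills on `ℤ^d` with the Wilson action at tree
coupling `b` (`W_q = (1/N) Re tr U_q`): under the any-`d` one-link modulus hypotheses, and hypothesis-free for every `N ≥ 2`,
`d ≥ 2` on the 't Hooft window `0 < b < N/(12(d−1))` (Bakry–Émery modulus; printed Shen–Zhu–Zhu window `1/(16(d−1))`), the
(unique) DLR state is INFINITELY differentiable in the coupling on Lipschitz cylinder observables; `C^∞`, NOT analyticity;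
nothing about the continuum, confinement at weak coupling, or the Clay problem.

* ★ `hasDerivAt_trunc_dim`, ★★ `hasDerivAt_truncSum_dim` (`R_n' = N R_{n+1}`), ★★ `iteratedDeriv_integral_eq_dim`,
  ★★★ `contDiffOn_infty_integral_dim` / `contDiffOn_infty_integral_dim_thooft` (every `N ≥ 2`, `d ≥ 2`),
  `contDiffOn_infty_plaquette_dim_thooft`, `iteratedDeriv_integral_eq_dim_thooft`.
-/

noncomputable section

open MeasureTheory ProbabilityTheory Function Finset Filter Topology Real Set
open scoped NNReal ContDiff
open Literature.MathematicalPhysics.QuantumLattice (LGConfig ZdEdge ZdPlaquette plaquetteEdges fundamentalRep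
  ymGibbsMeasures)
open Literature.MathematicalPhysics.QuantumFieldTheory hiding ZdEdge
open Literature.MathematicalPhysics.QuantumFieldTheory.Balaban1983to89.StrongCouplingDobrushinWindow (OneLinkKRModulus)
open Literature.MathematicalPhysics.QuantumFieldTheory.Balaban1983to89.StrongCouplingKernelWindow (oneLinkKRModulus_SU)
open Literature.Probability.LatticeModels (Site Site.supNorm Site.norm_eq_supNorm)
open Summit.Ventures.YMGap.StarResolventDim (gaugeR doorPoly)
open Summit.Ventures.YMGap.RobustBall (l1 numOrient)
open Summit.Ventures.YMGap.Cumulants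

namespace Summit.Ventures.YMGap.CouplingResponse

variable {d N : ℕ}

/-- Local shorthand: the normalised plaquette observable `W_q = (1/N) Re tr U_q` of `SU(N)` on `ℤ^d`, as a family. -/
local notation3 (prettyPrint := false) "𝓦" =>
  fun q : ZdPlaquette d => zdPlaquetteObs (d := d) (fundamentalRep (Fin N)) (Prod.fst q) (Prod.snd q).1.1 (Prod.snd q).1.2

/-! ### §1 Products of slots (`SU(N)` on `ℤ^d`) -/

/-- **Every product of slots of `(F; W_{q 0}; …)` is a bounded Lipschitz cylinder supported near `x₀`** (`SU(N)` on `ℤ^d`). -/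
theorem slots_prod_dim {F : LGConfig d (Matrix.specialUnitaryGroup (Fin N) ℂ) → ℝ} {Λ : Finset (ZdEdge d)} {K : ℝ≥0}
    (hF : IsLipschitzCylinder (fundamentalRep (Fin N)) F Λ K)
    {x₀ : Site d} {D : ℕ} (hD : ∀ e ∈ Λ, ‖e.1 - x₀‖ ≤ D) {n : ℕ} (q : Fin n → ZdPlaquette d) (T : Finset ℕ) :
    ∃ (ΛT : Finset (ZdEdge d)) (KT MT : ℝ≥0) (DT : ℕ),
      IsLipschitzCylinder (fundamentalRep (Fin N)) (fun U => ∏ i ∈ T, slots F 𝓦 q i U) ΛT KT ∧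
      (∀ U, |∏ i ∈ T, slots F 𝓦 q i U| ≤ MT) ∧ ∀ e ∈ ΛT, ‖e.1 - x₀‖ ≤ DT := by
  classical
  choose Λs cs hL hM hc hnear hcs0 hcsq using slot_data_dim (N := N) (d := d) hF hD q
  have hB : (1 : ℝ≥0) ≤ ‖F 1‖₊ + 2 * K + 1 := le_add_self
  obtain ⟨hLT, hBT⟩ := isLipschitzCylinder_prod hB T (fun i _ => hL i) (fun i _ => hM i)
  refine ⟨T.biUnion Λs, _, _, D + 1 + ∑ i ∈ T, Site.supNorm (cs i - x₀), hLT, hBT, fun e he => ?_⟩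
  obtain ⟨i, hi, hei⟩ := Finset.mem_biUnion.1 he
  have h1 := hnear i e hei
  have h2 : ‖cs i - x₀‖ ≤ ((∑ j ∈ T, Site.supNorm (cs j - x₀) : ℕ) : ℝ) := by
    rw [Site.norm_eq_supNorm]
    exact_mod_cast Finset.single_le_sum (f := fun j => Site.supNorm (cs j - x₀)) (fun j _ => Nat.zero_le _) hi
  calc ‖e.1 - x₀‖ = ‖(e.1 - cs i) + (cs i - x₀)‖ := by congr 1; abel
    _ ≤ ‖e.1 - cs i‖ + ‖cs i - x₀‖ := norm_add_le _ _
    _ ≤ _ := by push_cast at h1 h2 ⊢; linarith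

/-! ### §2 `d/db u_{n+1} = N Σ_r u_{n+2}` -/

/-- ★ **`d/db u_{n+1}(F; W_{q 0}; …; W_{q (n−1)})_{μ b} = N · Σ_r u_{n+2}(F; W_{q 0}; …; W_r)_{μ b}`** (`SU(N)` on `ℤ^d`,
modulus hypotheses, any DLR selection on `[0, b₁]`, every `0 < b < b₁`). -/
theorem hasDerivAt_trunc_dim (hd : 2 ≤ d) (hN : 1 ≤ N) {R Kc b₁ : ℝ} (hK0 : 0 ≤ Kc)
    (hmod : OneLinkKRModulus N R Kc) (hR : b₁ / N * (2 * ((d : ℝ) - 1)) ≤ R) (hdoor : doorPoly d (Kc * (b₁ / N)) < 1)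
    {μ : ℝ → Measure (LGConfig d (Matrix.specialUnitaryGroup (Fin N) ℂ))}
    (hμ : ∀ b ∈ Icc (0 : ℝ) b₁, μ b ∈ ymGibbsMeasures (d := d) (fundamentalRep (Fin N)) b)
    {F : LGConfig d (Matrix.specialUnitaryGroup (Fin N) ℂ) → ℝ} {Λ : Finset (ZdEdge d)} {K : ℝ≥0}
    (hF : IsLipschitzCylinder (fundamentalRep (Fin N)) F Λ K)
    {x₀ : Site d} {D : ℕ} (hD : ∀ e ∈ Λ, ‖e.1 - x₀‖ ≤ D) {n : ℕ} (q : Fin n → ZdPlaquette d)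
    {b : ℝ} (hb : b ∈ Ioo (0 : ℝ) b₁) :
    HasDerivAt (fun t => trunc (μ t) F 𝓦 q)
      ((N : ℝ) * ∑' r : ZdPlaquette d, trunc (μ b) F 𝓦 (Fin.snoc q r : Fin (n + 1) → ZdPlaquette d)) b := by
  classical
  have hbI : b ∈ Icc (0 : ℝ) b₁ := ⟨hb.1.le, hb.2.le⟩
  haveI : IsProbabilityMeasure (μ b) := (hμ b hbI).1
  set S : Finset ℕ := Finset.range (n + 1) with hS
  set X := slots F 𝓦 q with hX
  choose ΛT KT MT DT hLT hMT hDT using slots_prod_dim (N := N) (d := d) hF hD q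
  set m'r : ZdPlaquette d → Finset ℕ → ℝ := fun r T => cov[fun U => ∏ i ∈ T, X i U, 𝓦 r; μ b] with hm'r
  set m' : Finset ℕ → ℝ := fun T => (N : ℝ) * ∑' r : ZdPlaquette d, m'r r T with hm'
  have hmom : ∀ T ⊆ S, HasDerivAt (fun t => mom (μ t) X T) (m' T) b := fun T _ =>
    hasDerivAt_integral_star_dim hd hN hK0 hmod hR hdoor hμ (hLT T) (hDT T) hb
  have hder := hasDerivAt_ac hmom 0 S subset_rfl
  refine hder.congr_deriv ?_
  have hs : ∀ T ⊆ S, Summable fun r => m'r r T := fun T _ =>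
    summable_cov_plaquette_star_dim hd hN hK0 hmod hR hdoor hbI.1 hbI.2 (hμ b hbI) (hLT T) (hDT T)
  obtain ⟨-, hsum⟩ := dac_tsum (m := mom (μ b) X) hs 0 S subset_rfl
  have em' : m' = fun T => (N : ℝ) * (fun T => ∑' r, m'r r T) T := rfl
  rw [em', dac_const_mul, ← hsum]
  congr 1
  refine tsum_congr fun r => ?_
  obtain ⟨hWr, hWrm, hWr1, -, -⟩ := plaquetteObs_data_dim (N := N) (d := d) r
  set M : Finset ℕ → ℝ := mom (μ b) (slots F 𝓦 (Fin.snoc q r : Fin (n + 1) → ZdPlaquette d)) with hM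
  have hsS : n + 1 ∉ S := by simp [hS]
  have hagree : ∀ i ∈ S, slots F 𝓦 (Fin.snoc q r : Fin (n + 1) → ZdPlaquette d) i = X i := fun i hi =>
    slots_snoc_of_le F _ q r (Nat.lt_succ_iff.1 (Finset.mem_range.1 hi))
  have hMm : ∀ T ⊆ S, M T = mom (μ b) X T := mom_congr (μ b) hagree
  have hlast := slots_snoc_last F
    (fun p : ZdPlaquette d => zdPlaquetteObs (d := d) (fundamentalRep (Fin N)) p.1 p.2.1.1 p.2.1.2) q r
  have hm'M : ∀ T ⊆ S, m'r r T = M (insert (n + 1) T) - mom (μ b) X T * M {n + 1} := by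
    intro T hTS
    have hsT : n + 1 ∉ T := fun h => hsS (hTS h)
    have e1 : M (insert (n + 1) T) = ∫ U, (∏ i ∈ T, X i U) * (𝓦 r) U ∂(μ b) := by
      simp only [hM, mom]
      refine integral_congr_ae (ae_of_all _ fun U => ?_)
      dsimp only
      rw [Finset.prod_insert hsT, hlast, mul_comm]
      congr 1
      exact Finset.prod_congr rfl fun i hi => by rw [hagree i (hTS hi)]
    have e2 : M {n + 1} = ∫ U, (𝓦 r) U ∂(μ b) := by
      simp only [hM, mom, Finset.prod_singleton]
      refine integral_congr_ae (ae_of_all _ fun U => ?_)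
      rw [hlast]
    rw [e1, e2, hm'r]
    exact covariance_eq_sub_of_abs_le (hLT T).measurable hWrm (hMT T) hWr1
  have key := dac_eq_ac_insert (a := 0) hsS hMm hm'M S subset_rfl (Finset.mem_range.2 (Nat.succ_pos n))
  rw [key]
  show ac M 0 (insert (n + 1) (Finset.range (n + 1))) = ac M 0 (Finset.range (n + 1 + 1))
  rw [← Finset.range_add_one]

/-! ### §3 `R_n' = N R_{n+1}`; `(d/db)ⁿ ⟨F⟩ = Nⁿ R_n`; `C^∞` -/

/-- ★★ **THE ORDER-`n` RESPONSE SERIES IS DIFFERENTIABLE, `R_n' = N · R_{n+1}`** (`SU(N)` on `ℤ^d`, modulus hypotheses). -/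
theorem hasDerivAt_truncSum_dim (hd : 2 ≤ d) (hN : 1 ≤ N) {R Kc b₁ : ℝ} (hK0 : 0 ≤ Kc)
    (hmod : OneLinkKRModulus N R Kc) (hR : b₁ / N * (2 * ((d : ℝ) - 1)) ≤ R) (hdoor : doorPoly d (Kc * (b₁ / N)) < 1)
    {μ : ℝ → Measure (LGConfig d (Matrix.specialUnitaryGroup (Fin N) ℂ))}
    (hμ : ∀ b ∈ Icc (0 : ℝ) b₁, μ b ∈ ymGibbsMeasures (d := d) (fundamentalRep (Fin N)) b)
    {F : LGConfig d (Matrix.specialUnitaryGroup (Fin N) ℂ) → ℝ} {Λ : Finset (ZdEdge d)} {K : ℝ≥0}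
    (hF : IsLipschitzCylinder (fundamentalRep (Fin N)) F Λ K)
    {x₀ : Site d} {D : ℕ} (hD : ∀ e ∈ Λ, ‖e.1 - x₀‖ ≤ D) (n : ℕ) {b : ℝ} (hb : b ∈ Ioo (0 : ℝ) b₁) :
    HasDerivAt (fun t => ∑' q : Fin n → ZdPlaquette d, trunc (μ t) F 𝓦 q)
      ((N : ℝ) * ∑' q : Fin (n + 1) → ZdPlaquette d, trunc (μ b) F 𝓦 q) b := by
  classical
  have hbI : b ∈ Icc (0 : ℝ) b₁ := ⟨hb.1.le, hb.2.le⟩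
  obtain ⟨A, ρ, hA0, hρ0, hρ1, hdom⟩ := tsum_abs_truncated_snoc_le_dim hd hN hK0 hmod hR hdoor hF hD n
  obtain ⟨A₀, ρ₀, -, -, -, hsum0⟩ := summable_truncated_dim hd hN hK0 hmod hR hdoor hF hD n
  obtain ⟨A₁, ρ₁, -, -, -, hsum1⟩ := summable_truncated_dim hd hN hK0 hmod hR hdoor hF hD (n + 1)
  set Z : ℝ := numOrient d * ((1 + ρ) / (1 - ρ)) ^ d with hZ
  have hZ0 : 0 ≤ Z := by
    have : 0 < 1 - ρ := by linarith
    positivity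
  have hN0 : (0 : ℝ) ≤ N := Nat.cast_nonneg _
  set u : (Fin n → ZdPlaquette d) → ℝ := fun q => (N : ℝ) * (A * Z) * ∏ i, ρ ^ l1 (x₀ - (q i).1) with hu
  have hu0 : ∀ q, 0 ≤ u q := fun q =>
    mul_nonneg (mul_nonneg hN0 (mul_nonneg hA0 hZ0)) (Finset.prod_nonneg fun i _ => pow_nonneg hρ0 _)
  have hus : Summable u :=
    (summable_pi_of_abs_le_prod (f := u) (mul_nonneg hN0 (mul_nonneg hA0 hZ0)) (fun r => pow_nonneg hρ0 _)
      (sum_pow_l1_plaquette_le_dim hρ0 hρ1 x₀) (fun q => by rw [abs_of_nonneg (hu0 q)])).1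
  have h := hasDerivAt_tsum_of_isPreconnected hus isOpen_Ioo (convex_Ioo (0 : ℝ) b₁).isPreconnected
    (g := fun q t => trunc (μ t) F 𝓦 q)
    (g' := fun q t => (N : ℝ) * ∑' r : ZdPlaquette d, trunc (μ t) F 𝓦 (Fin.snoc q r : Fin (n + 1) → ZdPlaquette d))
    (fun q t ht => hasDerivAt_trunc_dim hd hN hK0 hmod hR hdoor hμ hF hD q ht) (fun q t ht => ?_) hb
    (hsum0 hbI.1 hbI.2 (hμ b hbI)).2.1 hb
  · refine h.congr_deriv ?_
    rw [tsum_mul_left, tsum_snoc_eq (hsum1 hbI.1 hbI.2 (hμ b hbI)).2.1]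
  · have htI : t ∈ Icc (0 : ℝ) b₁ := ⟨ht.1.le, ht.2.le⟩
    obtain ⟨hs, hle⟩ := hdom htI.1 htI.2 (hμ t htI) q
    rw [norm_mul, Real.norm_natCast]
    show (N : ℝ) * _ ≤ (N : ℝ) * (A * Z) * ∏ i, ρ ^ l1 (x₀ - (q i).1)
    rw [mul_assoc (N : ℝ)]
    refine mul_le_mul_of_nonneg_left ((norm_tsum_le_tsum_norm hs.norm).trans ?_) hN0
    simpa only [Real.norm_eq_abs, hZ] using hle

/-- Order zero of the response series is the mean (`SU(N)` on `ℤ^d`). -/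
theorem tsum_trunc_fin_zero_dim {P : Type*} (μ : Measure (LGConfig d (Matrix.specialUnitaryGroup (Fin N) ℂ)))
    (F : LGConfig d (Matrix.specialUnitaryGroup (Fin N) ℂ) → ℝ)
    (W : P → LGConfig d (Matrix.specialUnitaryGroup (Fin N) ℂ) → ℝ) :
    ∑' q : Fin 0 → P, trunc μ F W q = ∫ U, F U ∂μ := by
  rw [tsum_fintype, Fintype.sum_unique]
  exact trunc_fin_zero μ F W _

/-- ★★ **`(d/db)ⁿ ⟨F⟩_{μ b} = Nⁿ · Σ_{q} u_{n+1}(F; W_{q 0}; …; W_{q (n−1)})_{μ b}`** at every `0 < b < b₁` (`SU(N)` on `ℤ^d`, modulus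
hypotheses, any DLR selection). -/
theorem iteratedDeriv_integral_eq_dim (hd : 2 ≤ d) (hN : 1 ≤ N) {R Kc b₁ : ℝ} (hK0 : 0 ≤ Kc)
    (hmod : OneLinkKRModulus N R Kc) (hR : b₁ / N * (2 * ((d : ℝ) - 1)) ≤ R) (hdoor : doorPoly d (Kc * (b₁ / N)) < 1)
    {μ : ℝ → Measure (LGConfig d (Matrix.specialUnitaryGroup (Fin N) ℂ))}
    (hμ : ∀ b ∈ Icc (0 : ℝ) b₁, μ b ∈ ymGibbsMeasures (d := d) (fundamentalRep (Fin N)) b)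
    {F : LGConfig d (Matrix.specialUnitaryGroup (Fin N) ℂ) → ℝ} {Λ : Finset (ZdEdge d)} {K : ℝ≥0}
    (hF : IsLipschitzCylinder (fundamentalRep (Fin N)) F Λ K)
    {x₀ : Site d} {D : ℕ} (hD : ∀ e ∈ Λ, ‖e.1 - x₀‖ ≤ D) (n : ℕ) :
    ∀ ⦃b : ℝ⦄, b ∈ Ioo (0 : ℝ) b₁ →
      iteratedDeriv n (fun t => ∫ U, F U ∂(μ t)) b =
        (N : ℝ) ^ n * ∑' q : Fin n → ZdPlaquette d, trunc (μ b) F 𝓦 q := by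
  induction n with
  | zero =>
    intro b _
    rw [iteratedDeriv_zero, tsum_trunc_fin_zero_dim, pow_zero, one_mul]
  | succ n ih =>
    intro b hb
    rw [iteratedDeriv_succ]
    have hev : iteratedDeriv n (fun t => ∫ U, F U ∂(μ t)) =ᶠ[𝓝 b]
        fun t => (N : ℝ) ^ n * ∑' q : Fin n → ZdPlaquette d, trunc (μ t) F 𝓦 q :=
      Filter.eventually_of_mem (Ioo_mem_nhds hb.1 hb.2) fun t ht => ih ht
    rw [hev.deriv_eq, ((hasDerivAt_truncSum_dim hd hN hK0 hmod hR hdoor hμ hF hD n hb).const_mul ((N : ℝ) ^ n)).deriv]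
    ring

/-- ★★★ **THE `SU(N)` STRONG-COUPLING STATE ON `ℤ^d` IS `C^∞` IN THE COUPLING** (modulus hypotheses): for any DLR selection `μ` on
`[0, b₁]` and every Lipschitz cylinder `F`, `b ↦ ⟨F⟩_{μ b}` is `ContDiffOn ℝ ∞` on `Ioo 0 b₁`. -/
theorem contDiffOn_infty_integral_dim (hd : 2 ≤ d) (hN : 1 ≤ N) {R Kc b₁ : ℝ} (hK0 : 0 ≤ Kc)
    (hmod : OneLinkKRModulus N R Kc) (hR : b₁ / N * (2 * ((d : ℝ) - 1)) ≤ R) (hdoor : doorPoly d (Kc * (b₁ / N)) < 1)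
    {μ : ℝ → Measure (LGConfig d (Matrix.specialUnitaryGroup (Fin N) ℂ))}
    (hμ : ∀ b ∈ Icc (0 : ℝ) b₁, μ b ∈ ymGibbsMeasures (d := d) (fundamentalRep (Fin N)) b)
    {F : LGConfig d (Matrix.specialUnitaryGroup (Fin N) ℂ) → ℝ} {Λ : Finset (ZdEdge d)} {K : ℝ≥0}
    (hF : IsLipschitzCylinder (fundamentalRep (Fin N)) F Λ K)
    {x₀ : Site d} {D : ℕ} (hD : ∀ e ∈ Λ, ‖e.1 - x₀‖ ≤ D) :
    ContDiffOn ℝ ∞ (fun t => ∫ U, F U ∂(μ t)) (Ioo (0 : ℝ) b₁) := by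
  classical
  set Rn : ℕ → ℝ → ℝ := fun n t => ∑' q : Fin n → ZdPlaquette d, trunc (μ t) F 𝓦 q with hRn
  have hderiv : ∀ n, ∀ t ∈ Ioo (0 : ℝ) b₁, HasDerivAt (Rn n) ((N : ℝ) * Rn (n + 1) t) t := fun n t ht =>
    hasDerivAt_truncSum_dim hd hN hK0 hmod hR hdoor hμ hF hD n ht
  have hall : ∀ M : ℕ, ∀ n, ContDiffOn ℝ M (Rn n) (Ioo (0 : ℝ) b₁) := by
    intro M
    induction M with
    | zero =>
      intro n
      exact contDiffOn_zero.2 fun t ht => (hderiv n t ht).continuousAt.continuousWithinAt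
    | succ M ih =>
      intro n
      rw [show ((M + 1 : ℕ) : WithTop ℕ∞) = (M : WithTop ℕ∞) + 1 by push_cast; rfl,
        contDiffOn_succ_iff_deriv_of_isOpen isOpen_Ioo]
      refine ⟨fun t ht => (hderiv n t ht).differentiableAt.differentiableWithinAt, fun h => absurd h (by simp), ?_⟩
      exact (contDiffOn_const.mul (ih (n + 1))).congr fun t ht => (hderiv n t ht).deriv
  have hR0 : ∀ t, Rn 0 t = ∫ U, F U ∂(μ t) := fun t => tsum_trunc_fin_zero_dim (μ t) F _
  exact (contDiffOn_infty.2 fun M => hall M 0).congr fun t _ => (hR0 t).symm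

/-- ★★★ **EVERY `SU(N)`, `N ≥ 2`, EVERY DIMENSION `d ≥ 2`, HYPOTHESIS-FREE** (Bakry–Émery modulus, `b₁ = N/(12(d−1))`): for
any DLR selection `μ` on `[0, N/(12(d−1))]` and every Lipschitz cylinder observable `F`, `b ↦ ⟨F⟩_{μ b}` is `C^∞` on
`(0, N/(12(d−1)))` ('t Hooft `(d−1) b/N < 1/12`). -/
theorem contDiffOn_infty_integral_dim_thooft (hd : 2 ≤ d) (hN : 2 ≤ N)
    {μ : ℝ → Measure (LGConfig d (Matrix.specialUnitaryGroup (Fin N) ℂ))}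
    (hμ : ∀ b ∈ Icc (0 : ℝ) ((N : ℝ) / (12 * ((d : ℝ) - 1))), μ b ∈ ymGibbsMeasures (d := d) (fundamentalRep (Fin N)) b)
    {F : LGConfig d (Matrix.specialUnitaryGroup (Fin N) ℂ) → ℝ} {Λ : Finset (ZdEdge d)} {K : ℝ≥0}
    (hF : IsLipschitzCylinder (fundamentalRep (Fin N)) F Λ K)
    {x₀ : Site d} {D : ℕ} (hD : ∀ e ∈ Λ, ‖e.1 - x₀‖ ≤ D) :
    ContDiffOn ℝ ∞ (fun t => ∫ U, F U ∂(μ t)) (Ioo (0 : ℝ) ((N : ℝ) / (12 * ((d : ℝ) - 1)))) := by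
  obtain ⟨h1, hK0, hdoor⟩ := bakryEmery_door_dim (N := N) hd (by omega)
  exact contDiffOn_infty_integral_dim hd (by omega) hK0 (oneLinkKRModulus_SU hN h1) le_rfl hdoor hμ hF hD

/-- ★★ **The `SU(N)` mean plaquette on `ℤ^d` is `C^∞` on `(0, N/(12(d−1)))`**, every `N ≥ 2`, `d ≥ 2`, hypothesis-free — no finite-order
transition of the lattice internal energy inside the window. -/
theorem contDiffOn_infty_plaquette_dim_thooft (hd : 2 ≤ d) (hN : 2 ≤ N)
    {μ : ℝ → Measure (LGConfig d (Matrix.specialUnitaryGroup (Fin N) ℂ))}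
    (hμ : ∀ b ∈ Icc (0 : ℝ) ((N : ℝ) / (12 * ((d : ℝ) - 1))), μ b ∈ ymGibbsMeasures (d := d) (fundamentalRep (Fin N)) b)
    (p : ZdPlaquette d) :
    ContDiffOn ℝ ∞ (fun t => ∫ U, zdPlaquetteObs (fundamentalRep (Fin N)) p.1 p.2.1.1 p.2.1.2 U ∂(μ t))
      (Ioo (0 : ℝ) ((N : ℝ) / (12 * ((d : ℝ) - 1)))) :=
  contDiffOn_infty_integral_dim_thooft hd hN hμ (isLipschitzCylinder_zdPlaquetteObs (N := N) p.1 p.2.2) (x₀ := p.1) (D := 1)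
    (fun e he => by simpa using norm_fst_sub_le_of_mem_plaquetteEdges he)

/-- ★★ **`(d/db)ⁿ ⟨F⟩ = Nⁿ R_n` for every `SU(N)`, `N ≥ 2`, every `d ≥ 2`, hypothesis-free**, at every `0 < b < N/(12(d−1))`. -/
theorem iteratedDeriv_integral_eq_dim_thooft (hd : 2 ≤ d) (hN : 2 ≤ N)
    {μ : ℝ → Measure (LGConfig d (Matrix.specialUnitaryGroup (Fin N) ℂ))}
    (hμ : ∀ b ∈ Icc (0 : ℝ) ((N : ℝ) / (12 * ((d : ℝ) - 1))), μ b ∈ ymGibbsMeasures (d := d) (fundamentalRep (Fin N)) b)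
    {F : LGConfig d (Matrix.specialUnitaryGroup (Fin N) ℂ) → ℝ} {Λ : Finset (ZdEdge d)} {K : ℝ≥0}
    (hF : IsLipschitzCylinder (fundamentalRep (Fin N)) F Λ K)
    {x₀ : Site d} {D : ℕ} (hD : ∀ e ∈ Λ, ‖e.1 - x₀‖ ≤ D) (n : ℕ)
    {b : ℝ} (hb : b ∈ Ioo (0 : ℝ) ((N : ℝ) / (12 * ((d : ℝ) - 1)))) :
    iteratedDeriv n (fun t => ∫ U, F U ∂(μ t)) b =
      (N : ℝ) ^ n * ∑' q : Fin n → ZdPlaquette d, trunc (μ b) F 𝓦 q := by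
  obtain ⟨h1, hK0, hdoor⟩ := bakryEmery_door_dim (N := N) hd (by omega)
  exact iteratedDeriv_integral_eq_dim hd (by omega) hK0 (oneLinkKRModulus_SU hN h1) le_rfl hdoor hμ hF hD n hb

end Summit.Ventures.YMGap.CouplingResponse

end
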